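import Mathlib
import Summits.ValiantsHypothesis.ValiantsHypothesis.Theorems.DivisionGapPerMultiplesHardRelDenseCompleteClass
import Summits.ValiantsHypothesis.ValiantsHypothesis.Theorems.DivisionGapPerMultiplesHardRelDenseHost
import Summits.ValiantsHypothesis.ValiantsHypothesis.Theorems.DivisionGapPerMultiplesHardStubTwoBandTable
import Literature.Combinatorics.Enumerative.VanDerWaerdenPermanentProofs
import Literature.Combinatorics.Enumerative.VanDerWaerdenPermanent
import Literature.Computability.AlgebraicComplexity.ArithCircuitProofs
import Literature.Computability.AlgebraicComplexity.PermanentIrreducible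

/-!
# `DivisionGap.PerMultiplesHard` (stmt-ValiantsHypothesis-5068), line `uncharged-face-walk`:
stub `stub_relDenseCompleteClassHard2` — the dense-host complete-class rung, TWO-HOST form

Let `per_G := Σ_{σ inside G} x^{μ_σ}` be the face permanent of a host `G ⊆ [n]²` (cells
`(row, column)`; `σ` is inside `G` when `(σ i, i) ∈ G` for every column `i`), `ζ := finRotate n`,
and `G ∩ ζ G = {(a, b) ∈ G : (ζ⁻¹ a, b) ∈ G}` its shift intersection.  The one-host rung
`RelDenseCompleteClass.relDenseCompleteClassHard` probes EVERY permutation inside `G ∩ ζ G`; here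
the probed host is an arbitrary sub-host `Y₀ ⊆ G ∩ ζ G`: the `f`-regular spanning subgraph
`Y' ⊆ Y₀` (`f ≥ 1`) and the upper mixing bound `e_{Y₀}(A, B) ≤ β · #A · #B + ε · n²` refer to
`Y₀`, while completeness of the torus-homogeneous cofactor `t` (balanced, close margins `(R, C)`
of offset `> n²`) still refers to `G`.  Conclusion (unconditional: van der Waerden's permanent
bound is `Literature.Combinatorics.Enumerative.VanDerWaerdenPermanent_holds`):

  `f^n · 5^{⌊n/10⌋} ≤ L(per_G · t) · (β n)^n · 4^{⌊n/10⌋} · exp (15 ε n / β + (log n + 12) / β)`.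

Proof = the one-host proof with `Y := Y₀`.
* `g := per_G · t` has margins `(R + 1, C + 1)` (`RelDenseCompleteClass.margins_facePer_mul`),
  all rows hit.
* For `π` inside `Y₀` (hence inside `G` and inside `ζ G`), `TwoBandTable.stub_twoBandTable`
  gives a table `M` with margins `(R, C)` whose cells `(a, b)` satisfy `π b = a` (then
  `(a, b) = (π b, b) ∈ G`) or `π b = ζ a` (then `a = ζ⁻¹ (π b)` and `(ζ⁻¹ (π b), b) ∈ G`); so
  `M.support ⊆ G`, `M ∈ supp t` by completeness, and `RelDenseCompleteClass.probe_facePer_mul`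
  lifts it to a `ζ`-spread probe in `supp g`.
* `RelDenseHost.stub_relDenseHost` (van der Waerden discharged, host `Y₀`, subgraph `Y'`,
  shift `ζ`, polynomial `g`, margins `(R + 1, C + 1)`) is the conclusion.
-/

noncomputable section

-- `Summit.ValiantsHypothesis.ValiantsHypothesis.…` is the tree's mandated layout (Sub = Summit).
set_option linter.dupNamespace false

namespace Summit.ValiantsHypothesis.ValiantsHypothesis.Theorems.DivisionGap.PerMultiplesHard.RelDenseCompleteClassTwoHost

open MvPolynomial Literature.Computability.AlgebraicComplexity
open scoped NNReal BigOperators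

/-! ### Probes inside a sub-host of `G ∩ ζ G` -/

/-- **Every permutation inside a sub-host `Y₀ ⊆ G ∩ ζ G` carries a `ζ`-spread probe in
`supp (per_G · t)`** (`ζ = finRotate n`) when `t` is complete on `G` for balanced, close margins
`(R, C)` of offset `> n²`: `TwoBandTable.stub_twoBandTable` gives a two-band table `M` with
margins `(R, C)`; its cells `(a, b)` satisfy `π b = a` (so `(a, b) = (π b, b) ∈ G`) or `π b = ζ a`
(so `a = ζ⁻¹ (π b)` and `(ζ⁻¹ (π b), b) ∈ G`), hence `M.support ⊆ G`, `M ∈ supp t` by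
completeness, and `RelDenseCompleteClass.probe_facePer_mul` lifts it. [folklore] -/
theorem probe_of_subhost {n : ℕ} (G Y₀ : Finset (Fin n × Fin n))
    (hY₀ : Y₀ ⊆ G.filter (fun e => ((finRotate n).symm e.1, e.2) ∈ G))
    {t : MvPolynomial (Fin n × Fin n) ℝ≥0} {R C : Fin n → ℕ}
    (hfull : ∀ M : (Fin n × Fin n) →₀ ℕ, M.support ⊆ G →
      (∀ i, ∑ j, M (i, j) = R i) → (∀ j, ∑ i, M (i, j) = C j) → M ∈ t.support)
    (hbal : ∑ i, R i = ∑ j, C j) (hclose : ∀ i j, R i ≤ C j + n ∧ C j ≤ R i + n)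
    (hoff : ∀ i, n ^ 2 + 1 ≤ R i) :
    ∀ π : Equiv.Perm (Fin n), (∀ j, (π j, j) ∈ Y₀) →
      ∃ m ∈ ((∑ σ ∈ (Finset.univ : Finset (Equiv.Perm (Fin n))).filter (fun σ => ∀ i, (σ i, i) ∈ G),
          monomial (permMonomial σ) (1 : ℝ≥0)) * t).support,
        ∀ e ∈ m.support, π e.2 = e.1 ∨ π e.2 = finRotate n e.1 := by
  classical
  intro π hπ
  have hπG : ∀ j, (π j, j) ∈ G := fun j => (Finset.mem_filter.mp (hY₀ (hπ j))).1
  have hπG' : ∀ j, ((finRotate n).symm (π j), j) ∈ G := fun j =>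
    (Finset.mem_filter.mp (hY₀ (hπ j))).2
  obtain ⟨M, hMprobe, hMR, hMC⟩ := TwoBandTable.stub_twoBandTable n π R C hbal hclose hoff
  have hMsupp : M.support ⊆ G := by
    intro e he
    rcases hMprobe e he with h1 | h2
    · have : e = (π e.2, e.2) := by rw [h1]
      rw [this]
      exact hπG e.2
    · have h3 : (finRotate n).symm (π e.2) = e.1 := by
        rw [h2]; exact (finRotate n).symm_apply_apply e.1
      have : e = ((finRotate n).symm (π e.2), e.2) := by rw [h3]
      rw [this]
      exact hπG' e.2
  exact RelDenseCompleteClass.probe_facePer_mul G π hπG (hfull M hMsupp hMR hMC) hMprobe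

/-! ### The rung -/

/-- **stub_relDenseCompleteClassHard2 — the dense-host complete-class rung, TWO-HOST form,
unconditional.**  `n ≥ 5`, `ζ = finRotate n`, per-host `G`, probed host
`Y₀ ⊆ G ∩ ζ G = {(a, b) ∈ G : (ζ⁻¹ a, b) ∈ G}`, `Y' ⊆ Y₀` an `f`-regular spanning subgraph
(`f ≥ 1`), upper mixing `e_{Y₀}(A, B) ≤ β · #A · #B + ε · n²` (`0 < β ≤ 1`, `0 ≤ ε ≤ 1`), `t`
torus-homogeneous and COMPLETE ON `G` with balanced close margins `(R, C)` of offset `> n²`: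
`f^n · 5^{⌊n/10⌋} ≤ L(per_G · t) · (β n)^n · 4^{⌊n/10⌋} · exp (15 ε n / β + (log n + 12) / β)`.
Proof: every `π` inside `Y₀` carries a `ζ`-spread probe in `supp (per_G · t)`
(`probe_of_subhost`), `per_G · t` has margins `(R + 1, C + 1)` with all rows hit
(`RelDenseCompleteClass.margins_facePer_mul`), and `RelDenseHost.stub_relDenseHost` with host
`Y₀` — its van der Waerden hypothesis discharged by
`Literature.Combinatorics.Enumerative.VanDerWaerdenPermanent_holds` — concludes.
[cite: JerrumSnir1982, §3–4] -/
theorem stub_relDenseCompleteClassHard2 :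
    ∀ n ≥ 5, ∀ (G Y₀ Y' : Finset (Fin n × Fin n)) (f : ℕ),
      Y₀ ⊆ G.filter (fun e => ((finRotate n).symm e.1, e.2) ∈ G) → Y' ⊆ Y₀ → 1 ≤ f →
      (∀ i : Fin n, (Finset.univ.filter fun j : Fin n => (i, j) ∈ Y').card = f) →
      (∀ j : Fin n, (Finset.univ.filter fun i : Fin n => (i, j) ∈ Y').card = f) →
      ∀ (β ε : ℝ), 0 < β → β ≤ 1 → 0 ≤ ε → ε ≤ 1 →
      (∀ A B : Finset (Fin n),
        ((Y₀.filter fun e => e.1 ∈ A ∧ e.2 ∈ B).card : ℝ) ≤ β * A.card * B.card + ε * (n : ℝ) ^ 2) →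
      ∀ (t : MvPolynomial (Fin n × Fin n) ℝ≥0) (R C : Fin n → ℕ),
        (∀ m ∈ t.support, (∀ i, ∑ j, m (i, j) = R i) ∧ (∀ j, ∑ i, m (i, j) = C j)) →
        (∀ M : (Fin n × Fin n) →₀ ℕ, M.support ⊆ G →
          (∀ i, ∑ j, M (i, j) = R i) → (∀ j, ∑ i, M (i, j) = C j) → M ∈ t.support) →
        ∑ i, R i = ∑ j, C j → (∀ i j, R i ≤ C j + n ∧ C j ≤ R i + n) → (∀ i, n ^ 2 + 1 ≤ R i) →
        (f : ℝ) ^ n * (5 : ℝ) ^ (n / 10) ≤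
          (complexity ((∑ σ ∈ (Finset.univ : Finset (Equiv.Perm (Fin n))).filter (fun σ => ∀ i, (σ i, i) ∈ G),
              monomial (permMonomial σ) (1 : ℝ≥0)) * t) : ℝ) * (β * n) ^ n * (4 : ℝ) ^ (n / 10) *
            Real.exp (15 * ε * n / β + (Real.log n + 12) / β) := by
  classical
  intro n hn G Y₀ Y' f hY₀ hY' hf hrow hcol β ε hβ hβ1 hε hε1 hmix t R C ht hfull hbal hclose hoff
  exact RelDenseHost.stub_relDenseHost
    Literature.Combinatorics.Enumerative.VanDerWaerdenPermanent_holds n hn Y₀ Y' f hY' hf hrow hcol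
    β ε hβ hβ1 hε hε1 hmix (finRotate n) _ (fun i => R i + 1) (fun j => C j + 1)
    (RelDenseCompleteClass.margins_facePer_mul G ht) (fun i => Nat.succ_ne_zero _)
    (probe_of_subhost G Y₀ hY₀ hfull hbal hclose hoff)

end Summit.ValiantsHypothesis.ValiantsHypothesis.Theorems.DivisionGap.PerMultiplesHard.RelDenseCompleteClassTwoHost

end
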